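import Literature.NumberTheory.EllipticCurves.HeegnerPointsOfConductorConjugationBirch
import Literature.NumberTheory.EllipticCurves.HeegnerPointsOfConductorGaloisOrbitBirchProofs
import Literature.NumberTheory.EllipticCurves.HeegnerPointReflectionHolds
import Literature.Barriers.BirchSwinnertonDyer.PAdicFunctionalEquationParityProofs
import HarnessLib

/-!
# Discharge of `GrossLMS1991.prop53_conj_pinned_birch` (Gross 1991, Prop. 5.3 under Birch's
# condition, PINNED on the Hilbert class field) — at the conductor level outright, and at every level
# modulo the Modularity Theorem `exists_isNewformOf`

Topic `NumberTheory/EllipticCurves`; namespace `Literature.NumberTheory.EllipticCurves.GrossLMS1991`.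
THEOREMS ONLY (no definition, no named fact, no `sorry`).

The named fact `prop53_conj_pinned_birch N W K` (`HeegnerPointsOfConductorConjugationBirch.lean`):
for `E/ℚ` with globally minimal model `W`, `K` imaginary quadratic, a parametrisation datum `Dt` at
level `N`, `4N ∣ β² − d_K` (Birch), `ι : K → ℂ`: there is ONE `σ₁ ∈ 𝒢_1 = Gal(K[1]/K)` such that at every
level `n ≠ 0` prime to `N`, for every `y ∈ E(K[n])` over `y(n) = φ(x(n))` and the complex conjugation
`τ_n` of `K[n]`, some `σ′ ∈ 𝒢_n` RESTRICTING TO `σ₁` has `τ_n y − ε σ′ y` torsion, `ε = −w(E)`. Its file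
says *"not provable in the tree today … the missing step is Shimura reciprocity at conductor `n`"*.
That step is now the tree's (`HeegnerPointsOfConductorGaloisOrbitBirchProofs`, Birch-keyed, on the
primitive level-transport engine), together with the PINNING lemma
`apply_kleinJ_heegnerPointOfConductor_one_of_levelTransport`. This file runs Gross's proof of Prop. 5.3
(*"`x_n^τ = w_N(x_n^{σ′})` … `w_N ∞` is the cusp `0` … torsion in the Jacobian"*) exactly as the
Summits-side `X11b.KolyvaginA53.h53_of_recM` does under the Heegner hypothesis — Atkin–Lehner
(`φ(w_N τ) = e φ(τ) + φ(0)`, `w(E) = −e`), `φ(−τ̄) = conj φ(τ)`, Manin–Drinfeld (`φ(0)` torsion) from the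
tree — with (i) Birch primitivity of the Fricke partner `Q*_n = (N, nβ, n²C)` replacing the Heegner
hypothesis, (ii) `σ′` = the restriction of the transitivity automorphism `σ_n ∈ Aut(ℂ/K)`, and (iii)
`σ₁` = the restriction of `σ_1`, the pin `σ′|_{K[1]} = σ₁` being `σ_n(j(x(1))) = j(τ_{(N,β,C)}) = σ_1(j(x(1)))`
and `K[1] = K(j(x(1)))` (`eqOn_ringClassField_of_apply_kleinJ_eq`).

* `prop53_conj_pinned_birch_conductorNorm` — the fact at the level `N = N_E` (where `w(E) = −e`
  is the tree's `rootNumber_eq_neg_frickeEigenvalue`), for every `W`, `K : Type`. UNCONDITIONAL.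
* `prop53_conj_birch_conductorNorm` / `prop53_conj_birch_of_exists_isNewformOf` — the printed (unpinned) sibling
  fact `GrossLMS1991.prop53_conj_birch`, by projection.
* `prop53_conj_pinned_birch_of_exists_isNewformOf` — the fact at EVERY level `N`, GIVEN the Modularity
  Theorem in the tree's form `exists_isNewformOf` (a newform of `W` at level `N_E`): a datum at level `N`
  and a newform at level `N_E` force `N = N_E` (`level_eq_conductorNorm_tfae`: Hecke's functional equation
  at level `N_E` determines the level). At a foreign level `N ≠ N_E` (which Carayol's theorem excludes but
  the tree cannot refute) `W.rootNumber` is a junk value and the sign `ε` of the fact is not provable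
  (cf. `PAdicFunctionalEquationParityProofs`, the same obstruction); every consumer applies the fact at
  `N = N_E` and lists a modularity fact anyway.

Consumer: crux `AdditiveBranchIMC.GordTwoRankZeroOffCaseOne` / `MultLower` of summit `BirchSwinnertonDyer`
(three-field road, field 2 = genus Kolyvagin system; hypothesis `hP53`). BSD is proved for no curve here.

## References
* [GrossLMS1991] B. H. Gross, *Kolyvagin's work on modular elliptic curves* (1991), (5.1)–(5.2), Prop. 5.3
  and proof (PDF p. 220).
* [Gross1984] B. H. Gross, *Heegner points on `X₀(N)`* (1984), §I.1, §5.
* [Darmon2004] H. Darmon, *Rational Points on Modular Elliptic Curves*, CBMS 101 (2004), Thm. 3.7, Prop. 3.11.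
* [AtkinLehner1970] A. O. L. Atkin, J. Lehner, *Hecke operators on `Γ₀(m)`*, Thm. 3.
* [Manin1972] Ju. I. Manin, *Parabolic points and zeta functions of modular curves*, Cor. 3.6.
* [DiamondShurman2005] F. Diamond, J. Shurman, *A First Course in Modular Forms*, Thm. 5.10.2.

## Tree search
`lean search 'prop53_conj_pinned_birch'`: the fact and its consumers (`…GenusKolyvaginPointsR`, `…ThreeFieldRowClosed*`,
`…TameRoadsMultClosed*`); no prior `_holds`. By name: `h53_of_recM` (Summits, not importable here; re-run),
`exists_ringEquiv_levelTransport_heegnerPointOfConductor_birch`, `map_pointGalHom_eq_phi_of_levelTransport`,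
`Darmon2004.exists_mem_ringClassGal_coe_eq`, `apply_kleinJ_heegnerPointOfConductor_one_of_levelTransport`,
`fricke_partner_mem_heegnerForms_of_coprime`, `eqOn_ringClassField_of_apply_kleinJ_eq`, `heegnerTau_negB_fricke`,
`φ_J_smul`, `φ_frickeGL_smul`, `rootNumber_eq_neg_frickeEigenvalue`, `isOfFinAddOrder_cuspZeroPoint`,
`level_eq_conductorNorm_tfae`.
-/

noncomputable section

open scoped Classical MatrixGroups ModularForm ComplexConjugate
open CongruenceSubgroup UpperHalfPlane Complex NumberField WeierstrassCurve
open Literature.NumberTheory.EllipticCurves Literature.NumberTheory.EllipticCurves.HeegnerForm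
open Literature.NumberTheory.EllipticCurves.ModularForms
open Literature.Barriers.BirchSwinnertonDyer

namespace Literature.NumberTheory.EllipticCurves.GrossLMS1991

/-- **Gross 1991 Prop. 5.3, Birch-keyed and pinned, AT THE CONDUCTOR LEVEL `N = N_E`** — the named fact
`prop53_conj_pinned_birch (W.conductorNorm ℤ) W K` HOLDS for every `W` and every `K : Type`. Proof: Birch
primitivity of the Fricke partners `Q*_n = (N, nβ, n²C)` (`β² − d_K = 4NC`); Shimura transitivity at
conductor `n` gives `σ_n ∈ Aut(ℂ/K)` with `LevelTransport N σ_n x(n) τ_{Q*_n}`, whose restriction `σ′ ∈ 𝒢_n`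
carries `y` over `φ(τ_{Q*_n})`; Gross's computation `conj φ(x(n)) − ε φ(τ_{Q*_n}) = φ(J x(n)) − ε φ(τ_{Q*_n})
= φ(w_N τ_{Q*_n}) − e φ(τ_{Q*_n}) = φ(0)` (torsion); and the pin: `σ_n` and `σ_1` agree at `j(x(1))` (both
give `j(τ_{(N, β, C)})`, `apply_kleinJ_heegnerPointOfConductor_one_of_levelTransport`), hence on `K[1]`.
[cite: GrossLMS1991, §5 Prop. 5.3 and proof (PDF p. 220), (5.2)] [cite: Gross1984, §5]
[cite: Darmon2004, Thm. 3.7, Prop. 3.11] [cite: AtkinLehner1970, Thm. 3] [cite: Manin1972, Cor. 3.6] -/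
theorem prop53_conj_pinned_birch_conductorNorm (W : WeierstrassCurve ℚ) [NeZero (W.conductorNorm ℤ)]
    (K : Type) [Field K] [NumberField K] :
    prop53_conj_pinned_birch (W.conductorNorm ℤ) W K := by
  intro _ _ hK Dt β ι hβ
  set N : ℕ := W.conductorNorm ℤ with hNdef
  set D : ℤ := NumberField.discr K with hDdef
  have hD0 : D < 0 := hK.discr_neg
  obtain ⟨C, hC⟩ := id hβ
  have hNC : (β ^ 2 - D) / 4 = N * C := by
    rw [hC, show (4 : ℤ) * N * C = 4 * (N * C) by ring, Int.mul_ediv_cancel_left _ (by norm_num)]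
  -- primitivity of `(N, β, C)` (Birch primitivity at `n = 1`)
  have hprim1 : ∀ d : ℤ, d ∣ (N : ℤ) → d ∣ β → d ∣ C → IsUnit d := fun d h1 h2 h3 ↦
    isUnit_of_dvd_fricke_partner hK.1 hC (m := 1) (Nat.coprime_one_left _) h1 (by simpa using h2)
      (by simpa using h3)
  -- the pin: the transitivity automorphism at conductor `1`, restricted to `K[1]`
  obtain ⟨σ1, hσ1K, hT1⟩ := exists_ringEquiv_levelTransport_heegnerPointOfConductor_birch hK ι hβ
    one_ne_zero (fricke_partner_mem_heegnerForms_of_coprime hK hC (m := 1) (Nat.coprime_one_left _))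
    (Int.ModEq.refl _)
  obtain ⟨σ₁, hσ₁mem, hσ₁coe⟩ := Darmon2004.exists_mem_ringClassGal_coe_eq hK ι one_ne_zero hσ1K
  have hσ1D : σ1 (sqrtDisc D) = sqrtDisc D := apply_sqrtDisc_discr_eq hK ι hσ1K
  have hj1 : σ1 (kleinJ (heegnerPointOfConductor D β 1)) = kleinJ (heegnerTau ((N : ℤ), β, C)) :=
    apply_kleinJ_heegnerPointOfConductor_one_of_levelTransport hD0 hC one_ne_zero (Nat.coprime_one_left _)
      hprim1 hσ1D hT1
  refine ⟨σ₁, hσ₁mem, ?_⟩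
  intro n hn hnN y hy τn hτn
  have hn0 : (0 : ℤ) < n := by exact_mod_cast Nat.pos_of_ne_zero hn
  have hDn : (n : ℤ) ^ 2 * D < 0 := mul_neg_of_pos_of_neg (pow_pos hn0 2) hD0
  -- the Fricke partner `Q*_n = (N, nβ, n²C)` at conductor `n`, and the transitivity automorphism `σ`
  set Qs : ℤ × ℤ × ℤ := ((N : ℤ), (n : ℤ) * β, (n : ℤ) ^ 2 * C) with hQsdef
  have hQs : Qs ∈ heegnerForms N ((n : ℤ) ^ 2 * D) := fricke_partner_mem_heegnerForms_of_coprime hK hC hnN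
  obtain ⟨σ, hσK, hT⟩ :=
    exists_ringEquiv_levelTransport_heegnerPointOfConductor_birch hK ι hβ hn hQs (Int.ModEq.refl _)
  obtain ⟨σ', hσ'mem, hσ'coe⟩ := Darmon2004.exists_mem_ringClassGal_coe_eq hK ι hn hσK
  have hσD : σ (sqrtDisc D) = sqrtDisc D := apply_sqrtDisc_discr_eq hK ι hσK
  refine ⟨σ', hσ'mem, ?_, ?_⟩
  · -- THE PIN: `σ` and `σ1` agree at `j(x(1))`, hence on `K[1] = K(j(x(1)))`
    intro x₁ x hx
    rw [hσ'coe, hσ₁coe, hx]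
    have hj : (σ : ℂ →+* ℂ) (kleinJ (heegnerPointOfConductor D β 1)) =
        (σ1 : ℂ →+* ℂ) (kleinJ (heegnerPointOfConductor D β 1)) := by
      rw [RingEquiv.coe_toRingHom, RingEquiv.coe_toRingHom, hj1]
      exact apply_kleinJ_heegnerPointOfConductor_one_of_levelTransport hD0 hC hn hnN hprim1 hσD hT
    exact eqOn_ringClassField_of_apply_kleinJ_eq hK ι hβ one_ne_zero (φ := (σ : ℂ →+* ℂ))
      (ψ := (σ1 : ℂ →+* ℂ)) (fun k ↦ by rw [RingEquiv.coe_toRingHom, RingEquiv.coe_toRingHom, hσK k, hσ1K k])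
      hj x₁.2
  · -- GROSS'S COMPUTATION (Prop. 5.3), as in `X11b.KolyvaginA53.h53_of_recM`
    obtain ⟨hQm, hQmB⟩ := heegnerFormOfConductor_mem_heegnerForms (N := N) hD0 hβ hn
    set Qm := heegnerFormOfConductor D β n with hQmdef
    have hback : HeegnerForm.negB (fricke N Qs) = Qm := by
      have hN0 : (N : ℤ) ≠ 0 := by exact_mod_cast NeZero.ne N
      simp only [hQsdef, hQmdef, HeegnerForm.negB, fricke, heegnerFormOfConductor, neg_neg, hNC,
        Int.ediv_self hN0]
      refine Prod.ext (by ring) (Prod.ext rfl rfl)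
    -- `J • x_n = w_N • τ_{Q*}`
    have hJx : J • heegnerTau Qm =
        ModularForms.glCast (ModularForms.frickeGL N : GL (Fin 2) ℚ) • heegnerTau Qs := by
      rw [← hback, heegnerTau_negB_fricke hDn hQs, J_smul_J_smul]
    -- Atkin–Lehner (tree): `f ∣ w_N = e f`, `e = ±1`, pointwise Fricke property, `w(E) = -e`
    have hAL : ∀ (N' : ℕ) [NeZero N'],
        IsNewform0.exists_frickeInvolution_eq_smul (N := N') (k := (2 : ℤ)) :=
      fun N' _ ↦ isNewform0_exists_frickeInvolution_eq_smul_two N'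
    have hw : frickeInvolution N 2 Dt.f = frickeEigenvalue Dt.f • Dt.f :=
      IsNewform0.frickeInvolution_eq_smul_of (hAL N) Dt.isNewformOf.1
    obtain ⟨e, he⟩ : ∃ e : ℤ, (e : ℂ) = frickeEigenvalue Dt.f := by
      rcases IsNewform0.frickeEigenvalue_eq_one_or_eq_neg_one_of (hAL N)
        Dt.isNewformOf.1 with h | h
      · exact ⟨1, by rw [h]; norm_num⟩
      · exact ⟨-1, by rw [h]; norm_num⟩
    have hW : IsFrickeEigen N Dt.f (e : ℂ) := by
      rw [he]
      exact isFrickeEigen_of_frickeInvolution_eq_smul N hw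
    have hroot : W.rootNumber = -e := by
      have h := rootNumber_eq_neg_frickeEigenvalue
        (IsNewform0.exists_functional_equation_two_of_frickeInvolution_eq_smul
          fun N' _ ↦ IsNewform0.frickeInvolution_eq_smul_of (hAL N'))
        (fun N' _ ↦ IsNewform0.frickeEigenvalue_eq_one_or_eq_neg_one_of (hAL N'))
        Dt.isNewformOf
      rw [← he] at h
      exact_mod_cast h
    -- Manin–Drinfeld (tree): `φ(0)` is torsion
    have hTor : IsOfFinAddOrder Dt.cuspZeroPoint :=
      isOfFinAddOrder_cuspZeroPoint Dt (exists_nsmul_modularSymbol_mem_periodLattice_of_isNewform0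
        Dt.isNewformOf.1 Dt.isNewformOf.coeffField_eq_bot)
    -- Shimura reciprocity at conductor `n` for the partner form (NOW A THEOREM): `σ' • y ↦ φ(τ_{Q*})`
    have hrec : WeierstrassCurve.Affine.Point.map (W' := W) (ringClassField K ι n).subtype.toRatAlgHom
        (pointGalHom W (ringClassField K ι n) σ' y) = Dt.φ (heegnerTau Qs) :=
      map_pointGalHom_eq_phi_of_levelTransport hK ι Dt hβ hn hQs hσK hT hσ'coe hy
    -- complex coordinates: `τ_n` acts as complex conjugation
    have hy' : WeierstrassCurve.Affine.Point.map (W' := W) (ringClassField K ι n).subtype.toRatAlgHom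
        y = Dt.φ (heegnerTau Qm) := by
      simpa only [heegnerPointComplexOfConductor, heegnerPointOfConductor] using hy
    have hτ : WeierstrassCurve.Affine.Point.map (W' := W) (ringClassField K ι n).subtype.toRatAlgHom
        (pointGalHom W (ringClassField K ι n) τn y) = conjPoint W (Dt.φ (heegnerTau Qm)) := by
      have hcomp : (ringClassField K ι n).subtype.toRatAlgHom.comp
          (τn : ringClassField K ι n →ₐ[ℚ] ringClassField K ι n) =
          conjRatAlgHom.comp (ringClassField K ι n).subtype.toRatAlgHom := by
        apply AlgHom.ext
        intro x
        simpa using hτn x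
      rw [pointGalHom_apply, WeierstrassCurve.Affine.Point.map_map, hcomp,
        ← WeierstrassCurve.Affine.Point.map_map, hy']
    -- `conj φ(x_n) − ε φ(τ_{Q*}) = φ(J x_n) − ε φ(τ_{Q*}) = φ(w_N τ_{Q*}) − e φ(τ_{Q*}) = φ(0)`
    have key : WeierstrassCurve.Affine.Point.map (W' := W) (ringClassField K ι n).subtype.toRatAlgHom
        (pointGalHom W (ringClassField K ι n) τn y -
          (-W.rootNumber) • pointGalHom W (ringClassField K ι n) σ' y) = Dt.cuspZeroPoint := by
      rw [map_sub, map_zsmul, hτ, hrec, ← φ_J_smul, hJx, φ_frickeGL_smul Dt hW, hroot, neg_neg,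
        add_sub_cancel_left]
    obtain ⟨k, hk, hk0⟩ := hTor.exists_nsmul_eq_zero
    refine isOfFinAddOrder_iff_nsmul_eq_zero.mpr ⟨k, hk, ?_⟩
    apply WeierstrassCurve.Affine.Point.map_injective (W' := W)
      (f := (ringClassField K ι n).subtype.toRatAlgHom)
    rw [map_nsmul, key, hk0, map_zero]

/-- **The named fact `GrossLMS1991.prop53_conj_pinned_birch` at EVERY level, modulo the Modularity Theorem
`exists_isNewformOf`** (a newform of `W` at level `N_E` — Wiles, Taylor–Wiles, BCDT Thm. A): a
parametrisation datum at level `N` together with a newform at level `N_E` forces `N = N_E`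
(`level_eq_conductorNorm_tfae`: Hecke's functional equation at level `N_E` determines the level,
Diamond–Shurman Thm. 5.10.2), and the conductor-level theorem applies. [cite: GrossLMS1991, §5 Prop. 5.3]
[cite: DiamondShurman2005, Thm. 5.10.2 and Thm. 8.8.3] -/
theorem prop53_conj_pinned_birch_of_exists_isNewformOf (hnf : exists_isNewformOf) (N : ℕ) [NeZero N]
    (W : WeierstrassCurve ℚ) (K : Type) [Field K] [NumberField K] :
    prop53_conj_pinned_birch N W K := by
  intro _ _ hK Dt β ι hβ
  haveI : NeZero (W.conductorNorm ℤ) := ⟨(W.conductorNorm_pos_holds).ne'⟩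
  have hN : N = W.conductorNorm ℤ :=
    ((level_eq_conductorNorm_tfae Dt.isNewformOf).out 1 0).mp (hnf W)
  subst hN
  exact prop53_conj_pinned_birch_conductorNorm W K hK Dt β ι hβ

/-- **The printed (unpinned) form `GrossLMS1991.prop53_conj_birch` at the conductor level** — *"`y_n^τ = ε·y_n^{σ'} +`
(torsion) for some `σ' ∈ 𝒢_n`"* under Birch's condition: the pinned theorem with the restriction clause forgotten.
[cite: GrossLMS1991, §5 Prop. 5.3 (PDF p. 220)] -/
theorem prop53_conj_birch_conductorNorm (W : WeierstrassCurve ℚ) [NeZero (W.conductorNorm ℤ)]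
    (K : Type) [Field K] [NumberField K] :
    prop53_conj_birch (W.conductorNorm ℤ) W K := by
  intro _ _ hK Dt β ι n hβ hn hnN y hy τn hτn
  obtain ⟨σ₁, -, h⟩ := prop53_conj_pinned_birch_conductorNorm W K hK Dt β ι hβ
  obtain ⟨σ', hσ', -, htor⟩ := h n hn hnN y hy τn hτn
  exact ⟨σ', hσ', htor⟩

/-- **The printed form `GrossLMS1991.prop53_conj_birch` at every level, modulo `exists_isNewformOf`.**
[cite: GrossLMS1991, §5 Prop. 5.3 (PDF p. 220)] [cite: DiamondShurman2005, Thm. 5.10.2 and Thm. 8.8.3] -/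
theorem prop53_conj_birch_of_exists_isNewformOf (hnf : exists_isNewformOf) (N : ℕ) [NeZero N]
    (W : WeierstrassCurve ℚ) (K : Type) [Field K] [NumberField K] :
    prop53_conj_birch N W K := by
  intro _ _ hK Dt β ι n hβ hn hnN y hy τn hτn
  obtain ⟨σ₁, -, h⟩ := prop53_conj_pinned_birch_of_exists_isNewformOf hnf N W K hK Dt β ι hβ
  obtain ⟨σ', hσ', -, htor⟩ := h n hn hnN y hy τn hτn
  exact ⟨σ', hσ', htor⟩

end Literature.NumberTheory.EllipticCurves.GrossLMS1991

end
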